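import Mathlib
import HarnessLib
import Summits.AtomisticToContinuum.FouriersLaw.Theses.JunctionLocality
import Summits.AtomisticToContinuum.FouriersLaw.Theorems.JunctionLocalitySuperadditiveResistanceStubTerminationLocalityAux6
import Summits.AtomisticToContinuum.FouriersLaw.Theorems.JunctionLocalitySuperadditiveResistanceStubTerminationLocalityAux7

/-!
# Termination locality in the κ-frame, helper VIII: the split identity; S1' ⇔ the FLUCTUATION bound
(stub `stub_terminationLocality` (S1') of line `floating-probe-bypass-laplacian`, skeleton v7, crux
`JunctionLocality.SuperadditiveResistance`, stmt-AtomisticToContinuum-11748)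

Helper VII (`…Aux7`): `JP_N = ⟨g_0∘R, V'(r_J) p_{N−1}⟩ = −(T²/γ)(K₀₀ + K₀₁) + κ⟨g_0∘R, H_N∘π_N⟩` for a resolvent family.
Here, at FIXED `N, M, κ` (exact): `terminationDynamic_split`, `kuboMatrix_zero_zero_sub_plainKubo_split` — splitting the
bare field's end gradient `∂_{p_{N−1}} g_N = (G_N/γ²) p_{N−1} + r_N`, the SPLIT κ-FRAME IDENTITY
`K₀₀ − G_N = (G_N/γ)(K₀₀ + K₀₁) − (γ²/T²)(S_N + Dyn_N^{fl}) − (G_N/T²) κ ⟨g_0∘R, H_N∘π_N⟩ + (γ²/T²) κ X_N`,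
`Dyn_N^{fl} = ⟨g_0∘R, V'(r_J)·r_N∘π_N⟩` (written out as a Bochner integral; no new definition). The Rayleigh part is
`+(G_N/γ)K₀₀` (renewal at the bathed site — of the size `G_N K₀₀` of the stub's right-hand side, NOT a gain) plus
`(G_N/γ)K₀₁` (`≤ 0` as soon as the transfer bath `0` → probe `N−1` is `≥ 0`); `kappa_mass_pairing_le` makes the new
`κ`-term `≤ G_N²` at fixed `N`. Then the REDUCTION:

* `oneBlock_of_fluctuationBound` — the FLUCTUATION BOUND (explicit hypothesis on a constant `C'`: for all `N, M ≥ 2`,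
  eventually in `κ → 0⁺`, for every resolvent family and plain forward field, only in the regime `G_N ≤ K₀₀`):
  `(G_N/γ) K₀₁ − (γ²/T²)(S_N + Dyn_N^{fl}) ≤ C' G_N K₀₀`, gives `K₀₀ − G_N ≤ C G_N K₀₀` with `C = 1/γ + max C' 0 + 2`;
* `stub_terminationLocality_of_fluctuationBound` (registered as `helper_terminationFluctuationReduction`) — **the
  registered stub follows from `∃ C', <fluctuation bound>`** (both blocks, block swap of resolvent families);
* `fluctuationBound_of_oneBlock` — conversely the stub's left-block clause implies the fluctuation bound
  (`C' = max C 0 + 2`): eventually in `κ` the two are EQUIVALENT — this reduction is LOSSLESS, whereas helper VI's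
  remainder bound `−(γ²/T²)(S_N + Dyn_N) ≤ C₁G_N²` is stronger (it forces `K₀₀ ≤ G_N(1 + C₁G_N)` eventually in `κ`;
  it is recovered by composing `oneBlock_of_remainderBound` with `fluctuationBound_of_oneBlock`).

So the `N`-uniform content of S1' is EXACTLY: a one-sided bound on the transfer coefficient `K₀₁(κ)` plus
`S_N + Dyn_N^{fl} = O(G_N K₀₀)` — end-site local-equilibrium deviations of the two response fields at a γ-bathed site; no
such estimate exists in the tree or in print (BLR 2000 §6.3). Nothing `N`-uniform is claimed. Standard axioms only.
-/

noncomputable section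

open MeasureTheory Filter Topology
open scoped ContDiff
open Literature.MathematicalPhysics.KineticTheory.HeatConduction
open Summit.AtomisticToContinuum.FouriersLaw.Theorems.SuperadditiveResistance.DeviceLiouville (kin deviceGenerator)
open Summit.AtomisticToContinuum.FouriersLaw.Theorems.SuperadditiveResistance.Kubo (rev memLp_rev memLp_hamiltonian)
open Summit.AtomisticToContinuum.FouriersLaw.Theorems.SuperadditiveResistance.TerminationLocality
  (swapFamily kuboMatrix_swapFamily_zero_zero)

namespace Summit.AtomisticToContinuum.FouriersLaw.Cruxes.SuperadditiveResistance.FloatingProbeBypassLaplacian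

section Split

variable {ω₂ lam β γ T : ℝ} {N M : ℕ}

/-- **Splitting the dynamic remainder along `p_{N−1}`** (linearity): for every slope `G`,
`Dyn_N = (G/γ²) JP_N + Dyn_N^{fl}(G)`. -/
theorem terminationDynamic_split (hω : 0 < ω₂) (hl : 0 ≤ lam) (hβ : 0 ≤ β) (hγ : 0 < γ) (hN : 1 ≤ N)
    (hM : 1 ≤ M) (hT : 0 < T) {g₀ : PhaseSpace (N + M) → ℝ} (hg₀C : ContDiff ℝ 2 g₀)
    (hg₀L : MemLp g₀ 2 ((pinnedChain ω₂ lam β γ).gibbsMeasure (N + M) T))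
    {gN : PhaseSpace N → ℝ} (hgC : ContDiff ℝ 2 gN) (hgL2 : MemLp gN 2 ((pinnedChain ω₂ lam β γ).gibbsMeasure N T))
    (hgpde : ∀ y, (pinnedChain ω₂ lam β γ).generator N T T gN y = -(kin N 0 y - T)) (G : ℝ) :
    terminationDynamic ω₂ lam β γ T hN hM g₀ gN =
      G / γ ^ 2 * (∫ x, g₀ (x.1, -x.2) * (junctionForce β hN hM x * x.2 ⟨N - 1, by omega⟩)
        ∂((pinnedChain ω₂ lam β γ).gibbsMeasure (N + M) T)) +
      ∫ x, g₀ (x.1, -x.2) * (junctionForce β hN hM x *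
        (partialP ⟨N - 1, by omega⟩ gN (x.1 ∘ Fin.castAdd M, x.2 ∘ Fin.castAdd M) - G / γ ^ 2 * x.2 ⟨N - 1, by omega⟩))
        ∂((pinnedChain ω₂ lam β γ).gibbsMeasure (N + M) T) := by
  set μ := (pinnedChain ω₂ lam β γ).gibbsMeasure (N + M) T with hμ
  have hrevL2 : MemLp (rev g₀) 2 μ := memLp_rev hω hl hβ (N + M) hT hg₀C.continuous hg₀L
  have hIfull := integrable_terminationDynamic hω hl hβ hγ hN hM hT hg₀C hg₀L hgC hgL2 hgpde
  have hIp : Integrable (fun x : PhaseSpace (N + M) =>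
      G / γ ^ 2 * (g₀ (x.1, -x.2) * (junctionForce β hN hM x * x.2 ⟨N - 1, by omega⟩))) μ :=
    (hrevL2.integrable_mul (memLp_junctionForce_mul_momentum hω hl hβ γ hN hM hT)).const_mul (G / γ ^ 2)
  unfold terminationDynamic
  have e : ∫ x, g₀ (x.1, -x.2) * (junctionForce β hN hM x *
      (partialP ⟨N - 1, by omega⟩ gN (x.1 ∘ Fin.castAdd M, x.2 ∘ Fin.castAdd M) - G / γ ^ 2 * x.2 ⟨N - 1, by omega⟩)) ∂μ =
      (∫ x, g₀ (x.1, -x.2) * (junctionForce β hN hM x *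
        partialP ⟨N - 1, by omega⟩ gN (x.1 ∘ Fin.castAdd M, x.2 ∘ Fin.castAdd M)) ∂μ) -
        G / γ ^ 2 * ∫ x, g₀ (x.1, -x.2) * (junctionForce β hN hM x * x.2 ⟨N - 1, by omega⟩) ∂μ := by
    rw [← integral_const_mul, ← integral_sub hIfull hIp]
    exact integral_congr_ae (ae_of_all _ fun x => by ring)
  rw [e]
  ring

/-- **THE SPLIT κ-FRAME TERMINATION IDENTITY (left block; fixed `N`, `M`, `κ`; exact).** For any family `g` whose
bath-`0` member is a `κ`-resolvent field of the device and any plain forward field `g_N` of the bare `N`-chain,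
with `G_N = plainKubo … g_N`, `K = kuboMatrix … g`:

  `K₀₀ − G_N = (G_N/γ)(K₀₀ + K₀₁) − (γ²/T²)(S_N + Dyn_N^{fl}(G_N)) − (G_N/T²) κ ⟨g_0∘R, H_N∘π_N⟩ + (γ²/T²) κ X_N`.

The first term is the Rayleigh part of the dynamic remainder, evaluated EXACTLY: `+(G_N/γ) K₀₀` (renewal at the
γ-bathed site, absorbed below by a constant `≥ 1/γ`) plus `(G_N/γ) K₀₁` (`≤ 0` as soon as the transfer from bath `0` to
the probe is `≥ 0`); only `S_N`, `Dyn_N^{fl}` and the one-sided size of `K₀₁` remain to be estimated `N`-uniformly. -/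
theorem kuboMatrix_zero_zero_sub_plainKubo_split (hω : 0 < ω₂) (hl : 0 ≤ lam) (hβ : 0 ≤ β) (hγ : 0 < γ)
    (hN : 1 ≤ N) (hM : 1 ≤ M) (hT : 0 < T) (κ : ℝ) (g : Fin 4 → PhaseSpace (N + M) → ℝ) (gN : PhaseSpace N → ℝ)
    (hg₀ : g 0 ∈ deviceResolventFields ω₂ lam β γ T N M 0 κ) (hgN : gN ∈ plainForwardFields ω₂ lam β γ T N) :
    kuboMatrix ω₂ lam β γ T N M g 0 0 - plainKubo ω₂ lam β γ T N gN =
      plainKubo ω₂ lam β γ T N gN / γ * (kuboMatrix ω₂ lam β γ T N M g 0 0 + kuboMatrix ω₂ lam β γ T N M g 0 1) -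
        γ ^ 2 / T ^ 2 * (terminationStatic ω₂ lam β γ T N M gN +
          ∫ x, g 0 (x.1, -x.2) * (junctionForce β hN hM x *
            (partialP ⟨N - 1, by omega⟩ gN (x.1 ∘ Fin.castAdd M, x.2 ∘ Fin.castAdd M) -
              plainKubo ω₂ lam β γ T N gN / γ ^ 2 * x.2 ⟨N - 1, by omega⟩))
            ∂((pinnedChain ω₂ lam β γ).gibbsMeasure (N + M) T)) -
        plainKubo ω₂ lam β γ T N gN / T ^ 2 * κ *
          terminationMass ω₂ lam β γ T N M (g 0) ((pinnedChain ω₂ lam β γ).hamiltonian N) +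
        γ ^ 2 / T ^ 2 * κ * terminationMass ω₂ lam β γ T N M (g 0) gN := by
  have hid := kuboMatrix_zero_zero_sub_plainKubo_resolvent hω hl hβ hγ hN hM hT κ g gN hg₀ hgN
  have hJP := junctionPowerPairing_eq_kubo hω hl hβ hγ hN hM hT κ g hg₀
  obtain ⟨hg₀C, hg₀L, -⟩ := hg₀
  obtain ⟨hgC, hgL2, -, hgpde⟩ := hgN
  have hsplit := terminationDynamic_split hω hl hβ hγ hN hM hT hg₀C hg₀L hgC hgL2 hgpde (plainKubo ω₂ lam β γ T N gN)
  rw [hid, hsplit, hJP]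
  field_simp
  ring

end Split

section Mass

variable {ω₂ lam β γ T : ℝ}

/-- **The `κ`-mass pairings are invisible eventually in `κ` (fixed `N`).** If `κ ‖g_0‖² ≤ T²/γ` then for every
`F ∈ L²(μ_T^{(N)})`, `G > 0`: `κ |⟨g_0∘R, F∘π_N⟩| ≤ T² G` once `κ ≤ T² γ G² / (‖F∘π_N‖² + 1)` (weighted AM–GM). -/
theorem kappa_mass_pairing_le {N M : ℕ} (hω : 0 < ω₂) (hl : 0 ≤ lam) (hβ : 0 ≤ β) (hγ : 0 < γ) (hN : 1 ≤ N)
    (hM : 1 ≤ M) (hT : 0 < T) {κ : ℝ} (hκ : 0 ≤ κ) {g₀ : PhaseSpace (N + M) → ℝ} (hg₀C : ContDiff ℝ 2 g₀)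
    (hg₀L : MemLp g₀ 2 ((pinnedChain ω₂ lam β γ).gibbsMeasure (N + M) T))
    (hκg : κ * ∫ x, g₀ x ^ 2 ∂((pinnedChain ω₂ lam β γ).gibbsMeasure (N + M) T) ≤ T ^ 2 / γ)
    {F : PhaseSpace N → ℝ} (hF : MemLp F 2 ((pinnedChain ω₂ lam β γ).gibbsMeasure N T)) {G : ℝ} (hG : 0 < G)
    (hκle : κ ≤ T ^ 2 * γ * G ^ 2 /
      ((∫ x, F (x.1 ∘ Fin.castAdd M, x.2 ∘ Fin.castAdd M) ^ 2 ∂((pinnedChain ω₂ lam β γ).gibbsMeasure (N + M) T)) + 1)) :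
    κ * |terminationMass ω₂ lam β γ T N M g₀ F| ≤ T ^ 2 * G := by
  set A := ∫ x, g₀ x ^ 2 ∂((pinnedChain ω₂ lam β γ).gibbsMeasure (N + M) T) with hA
  set B := ∫ x, F (x.1 ∘ Fin.castAdd M, x.2 ∘ Fin.castAdd M) ^ 2 ∂((pinnedChain ω₂ lam β γ).gibbsMeasure (N + M) T)
    with hB
  have hB0 : 0 ≤ B := integral_nonneg fun x => sq_nonneg _
  have hε : 0 < γ * G := mul_pos hγ hG
  have h1 := abs_terminationMass_le hω hl hβ hN hM hT hg₀C hg₀L hF hε (γ := γ)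
  rw [← hA, ← hB] at h1
  have h2 : γ * G * (κ * A) ≤ γ * G * (T ^ 2 / γ) := mul_le_mul_of_nonneg_left hκg hε.le
  have h3 : κ * B ≤ T ^ 2 * γ * G ^ 2 := by
    have hB1 : 0 < B + 1 := by linarith
    calc κ * B ≤ κ * (B + 1) := by nlinarith
      _ ≤ T ^ 2 * γ * G ^ 2 / (B + 1) * (B + 1) := mul_le_mul_of_nonneg_right hκle hB1.le
      _ = T ^ 2 * γ * G ^ 2 := by field_simp
  have h4 : (γ * G)⁻¹ * (κ * B) ≤ (γ * G)⁻¹ * (T ^ 2 * γ * G ^ 2) := mul_le_mul_of_nonneg_left h3 (inv_nonneg.mpr hε.le)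
  have e4 : (γ * G)⁻¹ * (T ^ 2 * γ * G ^ 2) = T ^ 2 * G := by field_simp
  have e2 : γ * G * (T ^ 2 / γ) = T ^ 2 * G := by field_simp
  calc κ * |terminationMass ω₂ lam β γ T N M g₀ F|
      ≤ κ * ((γ * G * A + (γ * G)⁻¹ * B) / 2) := mul_le_mul_of_nonneg_left h1 hκ
    _ = (γ * G * (κ * A) + (γ * G)⁻¹ * (κ * B)) / 2 := by ring
    _ ≤ (T ^ 2 * G + T ^ 2 * G) / 2 := by linarith [h2, h4, e2, e4]
    _ = T ^ 2 * G := by ring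

end Mass

section Reduction

variable {ω₂ lam β γ T : ℝ}

/-- **ONE BLOCK FROM THE FLUCTUATION BOUND.** The `N`-uniform content of S1' AFTER the exact evaluation of the
Rayleigh term, written out as an explicit hypothesis on a constant `C'` (for all splits `N, M ≥ 2`, eventually in
`κ → 0⁺`, for every resolvent family `g`, every plain forward field `g_N`, and ONLY in the regime `G_N ≤ K₀₀` — the other
regime is free): `(G_N/γ) K₀₁ − (γ²/T²)(S_N + Dyn_N^{fl}(G_N)) ≤ C' · G_N · K₀₀`. It gives the division-free LEFT-block
clause of S1', eventually in `κ`, with `C = 1/γ + max C' 0 + 2`: the Rayleigh part contributes exactly `(G_N/γ) K₀₀`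
(absorbed by `C ≥ 1/γ`) plus `(G_N/γ) K₀₁` (left in the hypothesis), the two `κ`-terms are `≤ G_N²` each at the
threshold fixed by THE plain forward field (`mass_term_le`, `kappa_mass_pairing_le`, `plainForwardField_unique'`),
`K₀₀ ≥ 0` (PSD), `G_N > 0` (`plainKubo_pos`). -/
theorem oneBlock_of_fluctuationBound (hω : 0 < ω₂) (hl : 0 < lam) (hβ : 0 < β) (hγ : 0 < γ) (hT : 0 < T)
    {C' : ℝ}
    (hC' : ∀ (N M : ℕ) (hN : 2 ≤ N) (hM : 2 ≤ M), ∃ κ₁ : ℝ, 0 < κ₁ ∧ ∀ κ : ℝ, 0 < κ → κ ≤ κ₁ →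
      ∀ (g : Fin 4 → PhaseSpace (N + M) → ℝ) (gN : PhaseSpace N → ℝ),
        (∀ a : Fin 4, g a ∈ deviceResolventFields ω₂ lam β γ T N M (termSite N M a) κ) →
        gN ∈ plainForwardFields ω₂ lam β γ T N →
        plainKubo ω₂ lam β γ T N gN ≤ kuboMatrix ω₂ lam β γ T N M g 0 0 →
        plainKubo ω₂ lam β γ T N gN / γ * kuboMatrix ω₂ lam β γ T N M g 0 1 -
            γ ^ 2 / T ^ 2 * (terminationStatic ω₂ lam β γ T N M gN +
              ∫ x, g 0 (x.1, -x.2) * (junctionForce β (show 1 ≤ N by omega) (show 1 ≤ M by omega) x *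
                (partialP ⟨N - 1, by omega⟩ gN (x.1 ∘ Fin.castAdd M, x.2 ∘ Fin.castAdd M) -
                  plainKubo ω₂ lam β γ T N gN / γ ^ 2 * x.2 ⟨N - 1, by omega⟩))
                ∂((pinnedChain ω₂ lam β γ).gibbsMeasure (N + M) T)) ≤
          C' * plainKubo ω₂ lam β γ T N gN * kuboMatrix ω₂ lam β γ T N M g 0 0) :
    ∃ C : ℝ, 0 ≤ C ∧ ∀ N M : ℕ, 2 ≤ N → 2 ≤ M → ∃ κ₁ : ℝ, 0 < κ₁ ∧ ∀ κ : ℝ, 0 < κ → κ ≤ κ₁ →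
      ∀ (g : Fin 4 → PhaseSpace (N + M) → ℝ) (gN : PhaseSpace N → ℝ),
        (∀ a : Fin 4, g a ∈ deviceResolventFields ω₂ lam β γ T N M (termSite N M a) κ) →
        gN ∈ plainForwardFields ω₂ lam β γ T N →
        kuboMatrix ω₂ lam β γ T N M g 0 0 - plainKubo ω₂ lam β γ T N gN ≤
          C * plainKubo ω₂ lam β γ T N gN * kuboMatrix ω₂ lam β γ T N M g 0 0 := by
  refine ⟨1 / γ + max C' 0 + 2, by positivity, fun N M hN hM => ?_⟩
  have hN1 : 1 ≤ N := by omega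
  have hM1 : 1 ≤ M := by omega
  obtain ⟨κh, hκh, hb⟩ := hC' N M hN hM
  -- THE plain forward field of the bare `N`-chain and the thresholds it fixes
  obtain ⟨gS, hgS⟩ := stub_plainForwardField ω₂ lam β γ T hω hl hβ hγ hT N hN
  set G := plainKubo ω₂ lam β γ T N gS with hGdef
  have hG : 0 < G :=
    Theorems.SuperadditiveResistance.KuboPlain.plainKubo_pos ω₂ lam β γ T hω hl hβ hγ hT N hN gS hgS
  set B2 := ∫ x, gS (x.1 ∘ Fin.castAdd M, x.2 ∘ Fin.castAdd M) ^ 2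
    ∂((pinnedChain ω₂ lam β γ).gibbsMeasure (N + M) T) with hB2
  have hB0 : 0 ≤ B2 := integral_nonneg fun x => sq_nonneg _
  set BH := ∫ x, (pinnedChain ω₂ lam β γ).hamiltonian N (x.1 ∘ Fin.castAdd M, x.2 ∘ Fin.castAdd M) ^ 2
    ∂((pinnedChain ω₂ lam β γ).gibbsMeasure (N + M) T) with hBH
  have hBH0 : 0 ≤ BH := integral_nonneg fun x => sq_nonneg _
  set κm : ℝ := T ^ 2 * G ^ 4 / (γ ^ 3 * (B2 + 1)) with hκm
  have hκm0 : 0 < κm := by positivity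
  set κe : ℝ := T ^ 2 * γ * G ^ 2 / (BH + 1) with hκe
  have hκe0 : 0 < κe := by positivity
  refine ⟨min κh (min κm κe), lt_min hκh (lt_min hκm0 hκe0), fun κ hκ hκle g gN hg hgN => ?_⟩
  -- uniqueness: `gN` is THE plain forward field
  have heq : gN = gS := plainForwardField_unique' hω hl.le hβ.le hγ (show 0 < N by omega) hT 0
    hgN.1 hgN.2.1 hgN.2.2.1 hgN.2.2.2 hgS.1 hgS.2.1 hgS.2.2.1 hgS.2.2.2
  subst heq
  set K := kuboMatrix ω₂ lam β γ T N M g 0 0 with hK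
  obtain ⟨-, hpsd, hmass⟩ := resolventFamily_kubo hω hl.le hβ.le hγ hT hN hM hκ.le hg
  have hK0 : 0 ≤ K := by
    have h0 := hpsd fun b => if b = 0 then 1 else 0
    have e : ∑ b : Fin 4, ∑ c : Fin 4, (if b = 0 then (1 : ℝ) else 0) * kuboMatrix ω₂ lam β γ T N M g b c *
        (if c = 0 then 1 else 0) = K := by
      simp [Finset.sum_ite_eq', ite_mul, mul_ite, hK]
    rw [e] at h0
    exact h0
  by_cases hKG : K < G
  · have : 0 ≤ (1 / γ + max C' 0 + 2) * G * K := by positivity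
    linarith
  · have hGK : G ≤ K := not_lt.mp hKG
    have hid := kuboMatrix_zero_zero_sub_plainKubo_split hω hl.le hβ.le hγ hN1 hM1 hT κ g gN (hg 0) hgN
    have hbd := hb κ hκ (hκle.trans (min_le_left _ _)) g gN hg hgN hGK
    have hmt := mass_term_le hω hl.le hβ.le hγ hN1 hM1 hT hκ.le (hg 0).1 (hg 0).2.1 (hmass 0) hgN.2.1 hG
      (hκle.trans ((min_le_right _ _).trans (min_le_left _ _)))
    have hen := kappa_mass_pairing_le hω hl.le hβ.le hγ hN1 hM1 hT hκ.le (hg 0).1 (hg 0).2.1 (hmass 0)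
      (memLp_hamiltonian hω hl.le hβ.le N hT) hG (hκle.trans ((min_le_right _ _).trans (min_le_right _ _)))
    set XH := terminationMass ω₂ lam β γ T N M (g 0) ((pinnedChain ω₂ lam β γ).hamiltonian N) with hXH
    have hj : -(G / T ^ 2 * κ * XH) ≤ G ^ 2 := by
      have h1 : κ * (-XH) ≤ κ * |XH| := mul_le_mul_of_nonneg_left (neg_le_abs XH) hκ.le
      have h2 : -(G / T ^ 2 * κ * XH) = G / T ^ 2 * (κ * (-XH)) := by ring
      rw [h2]
      calc G / T ^ 2 * (κ * (-XH)) ≤ G / T ^ 2 * (T ^ 2 * G) :=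
            mul_le_mul_of_nonneg_left (h1.trans hen) (by positivity)
        _ = G ^ 2 := by field_simp
    have hC : C' * G * K ≤ max C' 0 * G * K := by
      have : 0 ≤ G * K := by positivity
      nlinarith [le_max_left C' 0]
    have hGK' : G ^ 2 ≤ G * K := by nlinarith
    calc K - G = G / γ * (K + kuboMatrix ω₂ lam β γ T N M g 0 1) -
          γ ^ 2 / T ^ 2 * (terminationStatic ω₂ lam β γ T N M gN +
            ∫ x, g 0 (x.1, -x.2) * (junctionForce β hN1 hM1 x *
            (partialP ⟨N - 1, by omega⟩ gN (x.1 ∘ Fin.castAdd M, x.2 ∘ Fin.castAdd M) - G / γ ^ 2 * x.2 ⟨N - 1, by omega⟩))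
            ∂((pinnedChain ω₂ lam β γ).gibbsMeasure (N + M) T)) - G / T ^ 2 * κ * XH +
          γ ^ 2 / T ^ 2 * κ * terminationMass ω₂ lam β γ T N M (g 0) gN := hid
      _ = G / γ * K + (G / γ * kuboMatrix ω₂ lam β γ T N M g 0 1 -
          γ ^ 2 / T ^ 2 * (terminationStatic ω₂ lam β γ T N M gN +
            ∫ x, g 0 (x.1, -x.2) * (junctionForce β hN1 hM1 x *
            (partialP ⟨N - 1, by omega⟩ gN (x.1 ∘ Fin.castAdd M, x.2 ∘ Fin.castAdd M) - G / γ ^ 2 * x.2 ⟨N - 1, by omega⟩))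
            ∂((pinnedChain ω₂ lam β γ).gibbsMeasure (N + M) T))) + (-(G / T ^ 2 * κ * XH)) +
          γ ^ 2 / T ^ 2 * κ * terminationMass ω₂ lam β γ T N M (g 0) gN := by ring
      _ ≤ G / γ * K + max C' 0 * G * K + G ^ 2 + G ^ 2 := by linarith [hbd.trans hC, hj, hmt]
      _ ≤ G / γ * K + max C' 0 * G * K + G * K + G * K := by linarith
      _ = (1 / γ + max C' 0 + 2) * G * K := by ring

/-- **THE REGISTERED STUB FROM THE FLUCTUATION BOUND.** A constant `C'` as in `oneBlock_of_fluctuationBound` gives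
`stub_terminationLocality` at these parameters: both blocks, division-free, eventually in `κ` — the right block is the
left block of the swapped split `(M, N)` (block swap of resolvent families, `K^{(M,N)}₀₀[g'] = K₃₃[g]`). -/
theorem stub_terminationLocality_of_fluctuationBound :
    ∀ ω₂ lam β γ T : ℝ, 0 < ω₂ → 0 < lam → 0 < β → 0 < γ → 0 < T →
      (∃ C' : ℝ, ∀ (N M : ℕ) (hN : 2 ≤ N) (hM : 2 ≤ M), ∃ κ₁ : ℝ, 0 < κ₁ ∧ ∀ κ : ℝ, 0 < κ → κ ≤ κ₁ →
        ∀ (g : Fin 4 → PhaseSpace (N + M) → ℝ) (gN : PhaseSpace N → ℝ),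
          (∀ a : Fin 4, g a ∈ deviceResolventFields ω₂ lam β γ T N M (termSite N M a) κ) →
          gN ∈ plainForwardFields ω₂ lam β γ T N →
          plainKubo ω₂ lam β γ T N gN ≤ kuboMatrix ω₂ lam β γ T N M g 0 0 →
          plainKubo ω₂ lam β γ T N gN / γ * kuboMatrix ω₂ lam β γ T N M g 0 1 -
              γ ^ 2 / T ^ 2 * (terminationStatic ω₂ lam β γ T N M gN +
                ∫ x, g 0 (x.1, -x.2) * (junctionForce β (show 1 ≤ N by omega) (show 1 ≤ M by omega) x *
                  (partialP ⟨N - 1, by omega⟩ gN (x.1 ∘ Fin.castAdd M, x.2 ∘ Fin.castAdd M) -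
                    plainKubo ω₂ lam β γ T N gN / γ ^ 2 * x.2 ⟨N - 1, by omega⟩))
                  ∂((pinnedChain ω₂ lam β γ).gibbsMeasure (N + M) T)) ≤
            C' * plainKubo ω₂ lam β γ T N gN * kuboMatrix ω₂ lam β γ T N M g 0 0) →
      ∃ C₁ : ℝ, ∀ N M : ℕ, 2 ≤ N → 2 ≤ M → ∃ κ₁ : ℝ, 0 < κ₁ ∧ ∀ κ : ℝ, 0 < κ → κ ≤ κ₁ →
        ∀ (g : Fin 4 → PhaseSpace (N + M) → ℝ) (gN : PhaseSpace N → ℝ) (gM : PhaseSpace M → ℝ),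
          (∀ a : Fin 4, g a ∈ deviceResolventFields ω₂ lam β γ T N M (termSite N M a) κ) →
          gN ∈ plainForwardFields ω₂ lam β γ T N → gM ∈ plainForwardFields ω₂ lam β γ T M →
          kuboMatrix ω₂ lam β γ T N M g 0 0 - plainKubo ω₂ lam β γ T N gN ≤
              C₁ * plainKubo ω₂ lam β γ T N gN * kuboMatrix ω₂ lam β γ T N M g 0 0 ∧
            kuboMatrix ω₂ lam β γ T N M g 3 3 - plainKubo ω₂ lam β γ T M gM ≤
              C₁ * plainKubo ω₂ lam β γ T M gM * kuboMatrix ω₂ lam β γ T N M g 3 3 := by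
  intro ω₂ lam β γ T hω hl hβ hγ hT h
  obtain ⟨C', hC'⟩ := h
  obtain ⟨C, -, hC⟩ := oneBlock_of_fluctuationBound hω hl hβ hγ hT hC'
  refine ⟨C, fun N M hN hM => ?_⟩
  obtain ⟨κa, hκa, ha⟩ := hC N M hN hM
  obtain ⟨κb, hκb, hb⟩ := hC M N hM hN
  refine ⟨min κa κb, lt_min hκa hκb, fun κ hκ hκle g gN gM hg hgN hgM => ⟨?_, ?_⟩⟩
  · exact ha κ hκ (hκle.trans (min_le_left _ _)) g gN hg hgN
  · have h' := hb κ hκ (hκle.trans (min_le_right _ _)) (swapFamily N M g) gM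
      (swapFamily_mem_resolvent (by omega) (by omega) hg) hgM
    have e : kuboMatrix ω₂ lam β γ T M N (swapFamily N M g) 0 0 = kuboMatrix ω₂ lam β γ T N M g 3 3 :=
      kuboMatrix_swapFamily_zero_zero ω₂ lam β γ T (show 1 ≤ N by omega) (show 1 ≤ M by omega) g
    rwa [e] at h'

/-- Registered helper sub-goal `helper_terminationFluctuationReduction` (= `stub_terminationLocality_of_fluctuationBound`
in stub form: the fluctuation bound written out as an explicit hypothesis on a constant `C'`). -/
theorem helper_terminationFluctuationReduction : ∀ (ω₂ lam β γ T : ℝ), 0 < ω₂ → 0 < lam → 0 < β → 0 < γ → 0 < T → ∀ (C' : ℝ), (∀ (N M : ℕ) (hN : 2 ≤ N) (hM : 2 ≤ M), ∃ κ₁ : ℝ, 0 < κ₁ ∧ ∀ κ : ℝ, 0 < κ → κ ≤ κ₁ → ∀ (g : Fin 4 → PhaseSpace (N + M) → ℝ) (gN : PhaseSpace N → ℝ), (∀ a : Fin 4, g a ∈ deviceResolventFields ω₂ lam β γ T N M (termSite N M a) κ) → gN ∈ plainForwardFields ω₂ lam β γ T N → plainKubo ω₂ lam β γ T N gN ≤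 kuboMatrix ω₂ lam β γ T N M g 0 0 → plainKubo ω₂ lam β γ T N gN / γ * kuboMatrix ω₂ lam β γ T N M g 0 1 - γ ^ 2 / T ^ 2 * (((∫ x, gN (x.1 ∘ Fin.castAdd M, x.2 ∘ Fin.castAdd M) * (kin (N + M) 0 x - T) ∂((pinnedChain ω₂ lam β γ).gibbsMeasure (N + M) T)) - ∫ y, gN y * (kin N 0 y - T) ∂((pinnedChain ω₂ lam β γ).gibbsMeasure N T)) + ∫ x, g 0 (x.1, -x.2) * ((((x.1 ⟨N, by omega⟩ - x.1 ⟨N - 1, by omega⟩) + β * (x.1 ⟨N, by omega⟩ - x.1 ⟨N - 1, by omega⟩) ^ 3) * (partialP ⟨N - 1, by omega⟩ gN (x.1 ∘ Fin.castAdd M, x.2 ∘ Fin.castAdd M) - plainKubo ω₂ lam β γ T N gN / γ ^ 2 * x.2 ⟨N - 1, by omega⟩))) ∂((pinnedChain ω₂ lam β γ).gibbsMeasure (N + M) T)) ≤ C' * plainKubo ω₂ lam β γ T N gN * kuboMatrix ω₂ lam β γ T N M g 0 0) → ∃ C : ℝ, ∀ N M : ℕ, 2 ≤ N → 2 ≤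 M → ∃ κ₁ : ℝ, 0 < κ₁ ∧ ∀ κ : ℝ, 0 < κ → κ ≤ κ₁ → ∀ (g : Fin 4 → PhaseSpace (N + M) → ℝ) (gN : PhaseSpace N → ℝ) (gM : PhaseSpace M → ℝ), (∀ a : Fin 4, g a ∈ deviceResolventFields ω₂ lam β γ T N M (termSite N M a) κ) → gN ∈ plainForwardFields ω₂ lam β γ T N → gM ∈ plainForwardFields ω₂ lam β γ T M → kuboMatrix ω₂ lam β γ T N M g 0 0 - plainKubo ω₂ lam β γ T N gN ≤ C * plainKubo ω₂ lam β γ T N gN * kuboMatrix ω₂ lam β γ T N M g 0 0 ∧ kuboMatrix ω₂ lam β γ T N M g 3 3 - plainKubo ω₂ lam β γ T M gM ≤ C * plainKubo ω₂ lam β γ T M gM * kuboMatrix ω₂ lam β γ T N M g 3 3 :=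
  fun ω₂ lam β γ T hω hl hβ hγ hT C' h => stub_terminationLocality_of_fluctuationBound ω₂ lam β γ T hω hl hβ hγ hT ⟨C', h⟩

/-- `X_N` is odd in the device field: `⟨(−g_0)∘R, F∘π_N⟩ = −⟨g_0∘R, F∘π_N⟩`. -/
theorem terminationMass_neg {N M : ℕ} (g₀ : PhaseSpace (N + M) → ℝ) (F : PhaseSpace N → ℝ) :
    terminationMass ω₂ lam β γ T N M (fun x => -g₀ x) F = -terminationMass ω₂ lam β γ T N M g₀ F := by
  unfold terminationMass
  rw [← integral_neg]
  exact integral_congr_ae (ae_of_all _ fun x => by ring)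

/-- **Conversely, the left-block clause of S1' implies the fluctuation bound** (so, eventually in `κ`, the fluctuation
bound is EQUIVALENT to the stub's left-block clause — the reduction of this file loses nothing, whereas helper VI's
remainder bound was strictly stronger): if `K₀₀ − G_N ≤ C G_N K₀₀` eventually in `κ` for all resolvent families and plain
forward fields, then the fluctuation bound holds with `C' = max C 0 + 2` (split identity; the two `κ`-terms are `≤ G_N²`
each at the threshold, `mass_term_le` for `±g_0` and `kappa_mass_pairing_le`). -/
theorem fluctuationBound_of_oneBlock (hω : 0 < ω₂) (hl : 0 < lam) (hβ : 0 < β) (hγ : 0 < γ) (hT : 0 < T) {C : ℝ}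
    (hC : ∀ N M : ℕ, 2 ≤ N → 2 ≤ M → ∃ κ₁ : ℝ, 0 < κ₁ ∧ ∀ κ : ℝ, 0 < κ → κ ≤ κ₁ →
      ∀ (g : Fin 4 → PhaseSpace (N + M) → ℝ) (gN : PhaseSpace N → ℝ),
        (∀ a : Fin 4, g a ∈ deviceResolventFields ω₂ lam β γ T N M (termSite N M a) κ) →
        gN ∈ plainForwardFields ω₂ lam β γ T N →
        kuboMatrix ω₂ lam β γ T N M g 0 0 - plainKubo ω₂ lam β γ T N gN ≤
          C * plainKubo ω₂ lam β γ T N gN * kuboMatrix ω₂ lam β γ T N M g 0 0) :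
    ∀ (N M : ℕ) (hN : 2 ≤ N) (hM : 2 ≤ M), ∃ κ₁ : ℝ, 0 < κ₁ ∧ ∀ κ : ℝ, 0 < κ → κ ≤ κ₁ →
      ∀ (g : Fin 4 → PhaseSpace (N + M) → ℝ) (gN : PhaseSpace N → ℝ),
        (∀ a : Fin 4, g a ∈ deviceResolventFields ω₂ lam β γ T N M (termSite N M a) κ) →
        gN ∈ plainForwardFields ω₂ lam β γ T N →
        plainKubo ω₂ lam β γ T N gN ≤ kuboMatrix ω₂ lam β γ T N M g 0 0 →
        plainKubo ω₂ lam β γ T N gN / γ * kuboMatrix ω₂ lam β γ T N M g 0 1 -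
            γ ^ 2 / T ^ 2 * (terminationStatic ω₂ lam β γ T N M gN +
              ∫ x, g 0 (x.1, -x.2) * (junctionForce β (show 1 ≤ N by omega) (show 1 ≤ M by omega) x *
                (partialP ⟨N - 1, by omega⟩ gN (x.1 ∘ Fin.castAdd M, x.2 ∘ Fin.castAdd M) -
                  plainKubo ω₂ lam β γ T N gN / γ ^ 2 * x.2 ⟨N - 1, by omega⟩))
                ∂((pinnedChain ω₂ lam β γ).gibbsMeasure (N + M) T)) ≤
          (max C 0 + 2) * plainKubo ω₂ lam β γ T N gN * kuboMatrix ω₂ lam β γ T N M g 0 0 := by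
  intro N M hN hM
  have hN1 : 1 ≤ N := by omega
  have hM1 : 1 ≤ M := by omega
  obtain ⟨κh, hκh, hb⟩ := hC N M hN hM
  obtain ⟨gS, hgS⟩ := stub_plainForwardField ω₂ lam β γ T hω hl hβ hγ hT N hN
  set G := plainKubo ω₂ lam β γ T N gS with hGdef
  have hG : 0 < G :=
    Theorems.SuperadditiveResistance.KuboPlain.plainKubo_pos ω₂ lam β γ T hω hl hβ hγ hT N hN gS hgS
  set B2 := ∫ x, gS (x.1 ∘ Fin.castAdd M, x.2 ∘ Fin.castAdd M) ^ 2
    ∂((pinnedChain ω₂ lam β γ).gibbsMeasure (N + M) T) with hB2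
  have hB0 : 0 ≤ B2 := integral_nonneg fun x => sq_nonneg _
  set BH := ∫ x, (pinnedChain ω₂ lam β γ).hamiltonian N (x.1 ∘ Fin.castAdd M, x.2 ∘ Fin.castAdd M) ^ 2
    ∂((pinnedChain ω₂ lam β γ).gibbsMeasure (N + M) T) with hBH
  have hBH0 : 0 ≤ BH := integral_nonneg fun x => sq_nonneg _
  set κm : ℝ := T ^ 2 * G ^ 4 / (γ ^ 3 * (B2 + 1)) with hκm
  have hκm0 : 0 < κm := by positivity
  set κe : ℝ := T ^ 2 * γ * G ^ 2 / (BH + 1) with hκe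
  have hκe0 : 0 < κe := by positivity
  refine ⟨min κh (min κm κe), lt_min hκh (lt_min hκm0 hκe0), fun κ hκ hκle g gN hg hgN hGK => ?_⟩
  have heq : gN = gS := plainForwardField_unique' hω hl.le hβ.le hγ (show 0 < N by omega) hT 0
    hgN.1 hgN.2.1 hgN.2.2.1 hgN.2.2.2 hgS.1 hgS.2.1 hgS.2.2.1 hgS.2.2.2
  subst heq
  set K := kuboMatrix ω₂ lam β γ T N M g 0 0 with hK
  obtain ⟨-, -, hmass⟩ := resolventFamily_kubo hω hl.le hβ.le hγ hT hN hM hκ.le hg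
  have hid := kuboMatrix_zero_zero_sub_plainKubo_split hω hl.le hβ.le hγ hN1 hM1 hT κ g gN (hg 0) hgN
  have hbd := hb κ hκ (hκle.trans (min_le_left _ _)) g gN hg hgN
  -- the two `κ`-terms
  have hκm' : κ ≤ κm := hκle.trans ((min_le_right _ _).trans (min_le_left _ _))
  have hneg : κ * ∫ x, (fun y => -g 0 y) x ^ 2 ∂((pinnedChain ω₂ lam β γ).gibbsMeasure (N + M) T) ≤ T ^ 2 / γ := by
    have e : (fun x => (fun y => -g 0 y) x ^ 2) = fun x => g 0 x ^ 2 := by funext x; ring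
    rw [e]; exact hmass 0
  have hmt := mass_term_le hω hl.le hβ.le hγ hN1 hM1 hT hκ.le ((hg 0).1.neg) ((hg 0).2.1.neg) hneg hgN.2.1 hG hκm'
  rw [terminationMass_neg] at hmt
  have hen := kappa_mass_pairing_le hω hl.le hβ.le hγ hN1 hM1 hT hκ.le (hg 0).1 (hg 0).2.1 (hmass 0)
    (memLp_hamiltonian hω hl.le hβ.le N hT) hG (hκle.trans ((min_le_right _ _).trans (min_le_right _ _)))
  set XH := terminationMass ω₂ lam β γ T N M (g 0) ((pinnedChain ω₂ lam β γ).hamiltonian N) with hXH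
  set X := terminationMass ω₂ lam β γ T N M (g 0) gN with hX
  have hj : G / T ^ 2 * κ * XH ≤ G ^ 2 := by
    calc G / T ^ 2 * κ * XH = G / T ^ 2 * (κ * XH) := by ring
      _ ≤ G / T ^ 2 * (T ^ 2 * G) :=
          mul_le_mul_of_nonneg_left ((mul_le_mul_of_nonneg_left (le_abs_self XH) hκ.le).trans hen) (by positivity)
      _ = G ^ 2 := by field_simp
  have hmt' : -(γ ^ 2 / T ^ 2 * κ * X) ≤ G ^ 2 := by
    have e : -(γ ^ 2 / T ^ 2 * κ * X) = γ ^ 2 / T ^ 2 * κ * (-X) := by ring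
    rw [e]; exact hmt
  have e : G / γ * kuboMatrix ω₂ lam β γ T N M g 0 1 -
      γ ^ 2 / T ^ 2 * (terminationStatic ω₂ lam β γ T N M gN + ∫ x, g 0 (x.1, -x.2) * (junctionForce β hN1 hM1 x *
            (partialP ⟨N - 1, by omega⟩ gN (x.1 ∘ Fin.castAdd M, x.2 ∘ Fin.castAdd M) - G / γ ^ 2 * x.2 ⟨N - 1, by omega⟩))
            ∂((pinnedChain ω₂ lam β γ).gibbsMeasure (N + M) T)) =
      (K - G) - G / γ * K + G / T ^ 2 * κ * XH + (-(γ ^ 2 / T ^ 2 * κ * X)) := by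
    rw [hid]; ring
  rw [e]
  have hK0 : 0 ≤ K := hG.le.trans hGK
  have hGK0 : 0 ≤ G / γ * K := by positivity
  have hGK' : G ^ 2 ≤ G * K := by nlinarith
  have hCC : C * G * K ≤ max C 0 * G * K := by
    have : 0 ≤ G * K := by positivity
    nlinarith [le_max_left C 0]
  calc K - G - G / γ * K + G / T ^ 2 * κ * XH + -(γ ^ 2 / T ^ 2 * κ * X)
      ≤ max C 0 * G * K - 0 + G ^ 2 + G ^ 2 := by linarith [hbd.trans hCC, hj, hmt', hGK0]
    _ ≤ max C 0 * G * K + G * K + G * K := by linarith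
    _ = (max C 0 + 2) * G * K := by ring

end Reduction

end Summit.AtomisticToContinuum.FouriersLaw.Cruxes.SuperadditiveResistance.FloatingProbeBypassLaplacian

end
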